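import Summits.ABC.ABC.Theses.RibetTakahashiSplit
import HarnessLib

/-!
# Route RibetTakahashiSplit — the cubic ω-lift behind item `OmegaLiftAssembly` (stmt-ABC-15513)

Helper file (`--supports stmt-ABC-15513`). It formalizes the elementary transfer described in the
item's informal statement (planner operator D, 2026-08-16; binomial-split family of
Martin–Miao, arXiv:1409.2974 §2.4, `n = 3`, `k = 2`):

* **cubic lift.** For an abc triple `(a, b, c)` put `m := 3a² + 3ab + b²`; then
  `a³ + b·m = c³`, `(a³, b·m, c³)` is again an abc triple, its radical is `≤ rad(abc)·m ≤ 3c²·rad(abc)`,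
  and `m` has a prime factor not dividing `abc` (a prime `p ∣ m`, `p ∣ abc` forces `p = 3 ∣ b`, and then
  `m/3 ≡ a² ≡ 1 (mod 3)` is `> 1`), so `ω(a³·bm·c³) ≥ ω(abc) + 1`;
* **transfer.** an abc bound `c < C·rad^{1+η}` on the lifted triple gives
  `c < C'·rad^{(1+η)/(1−2η)}` on the original one; with `η := ε/(3+2ε)` the exponent is `1 + ε`;
* **ω-lift.** hence, for every fixed `k`, the abc conjecture for the triples with at least `k` prime
  factors of `abc` (resp. at least `k` ODD prime factors) already implies `ABC`
  (`OmegaLift.abc_of_manyPrimes`, `OmegaLift.abc_of_manyOddPrimes`).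

This is the glue the route planner needs if the weighted Szpiro crux r3′ is ever re-cut to curves with
≥ 4 odd multiplicative primes (the regime of the Jacquet–Langlands mechanism); with r3′ as filed the
item itself is immediate (`omegaLiftAssembly_proof`, Theorems/RibetTakahashiSplitOmegaLiftAssembly.lean).

No definitions, no named facts; elementary (Mathlib radical / primeFactors API and `Real.log`/`exp`).
-/

-- `Summit.<Summit>.<Problem>` is the mandated summit-side namespace (CONVENTIONS §2); for the
-- single-conjunct summit `ABC` the two coincide, so the duplicate `ABC.ABC` is deliberate.
set_option linter.dupNamespace false

noncomputable section

open UniqueFactorizationMonoid Literature.NumberTheory.DiophantineGeometry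

namespace Summit.ABC.ABC.Theorems

namespace OmegaLift

/-! ### The cubic lift `(a, b, c) ↦ (a³, b·(3a² + 3ab + b²), c³)` -/

/-- The binomial identity behind the cubic lift: `a³ + b·(3a² + 3ab + b²) = (a + b)³`. [folklore] -/
theorem cube_add_eq (a b : ℕ) : a ^ 3 + b * (3 * a ^ 2 + 3 * a * b + b ^ 2) = (a + b) ^ 3 := by
  ring

/-- A prime dividing both members of a coprime pair does not exist: if `x ⊥ y`, `p ∣ y` then `p ∤ x`.
[folklore] -/
theorem not_dvd_of_coprime {p x y : ℕ} (hp : p.Prime) (hxy : Nat.Coprime x y) (hpy : p ∣ y) :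
    ¬ p ∣ x := by
  intro hpx
  have h := Nat.dvd_gcd hpx hpy
  rw [hxy.gcd_eq_one] at h
  exact hp.one_lt.ne' (Nat.dvd_one.mp h)

/-- The cofactor `m = 3a² + 3ab + b² ≡ b² (mod a)` is coprime to `a` when `a ⊥ b`. [folklore] -/
theorem coprime_left_cofactor {a b : ℕ} (h : Nat.Coprime a b) :
    Nat.Coprime a (3 * a ^ 2 + 3 * a * b + b ^ 2) := by
  have e : 3 * a ^ 2 + 3 * a * b + b ^ 2 = b ^ 2 + a * (3 * a + 3 * b) := by ring
  rw [e, Nat.coprime_add_mul_left_right]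
  exact h.pow_right 2

/-- The cofactor `m = 3a(a + b) + b² ≡ b² (mod a + b)` is coprime to `c = a + b` when `a ⊥ b`.
[folklore] -/
theorem coprime_sum_cofactor {a b : ℕ} (h : Nat.Coprime a b) :
    Nat.Coprime (a + b) (3 * a ^ 2 + 3 * a * b + b ^ 2) := by
  have e : 3 * a ^ 2 + 3 * a * b + b ^ 2 = b ^ 2 + (a + b) * (3 * a) := by ring
  rw [e, Nat.coprime_add_mul_left_right]
  exact (Nat.coprime_add_self_left.mpr h).pow_right 2

/-- The cubic lift of an abc triple is an abc triple: `(a³, b·(3a² + 3ab + b²), c³)`. [folklore] -/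
theorem isABCTriple_lift {a b c : ℕ} (h : IsABCTriple a b c) :
    IsABCTriple (a ^ 3) (b * (3 * a ^ 2 + 3 * a * b + b ^ 2)) (c ^ 3) := by
  obtain ⟨ha, hb, hsum, hcop⟩ := h
  refine ⟨pow_pos ha 3, Nat.mul_pos hb (Nat.add_pos_right _ (pow_pos hb 2)), ?_, ?_⟩
  · rw [← hsum, cube_add_eq]
  · exact (Nat.Coprime.mul_right hcop (coprime_left_cofactor hcop)).pow_left 3

/-- The cofactor is at most `3c²`: `3a² + 3ab + b² ≤ 3(a + b)²`. [folklore] -/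
theorem cofactor_le {a b c : ℕ} (h : IsABCTriple a b c) :
    3 * a ^ 2 + 3 * a * b + b ^ 2 ≤ 3 * c ^ 2 := by
  obtain ⟨-, -, hsum, -⟩ := h
  subst hsum
  nlinarith [Nat.zero_le (a * b), Nat.zero_le (b ^ 2)]

/-- **The new prime.** For an abc triple, the cofactor `m = 3a² + 3ab + b²` has a prime factor not
dividing `abc`: a common prime `p` of `m` and `abc` must be `p = 3` with `3 ∣ b` (as `m ⊥ a`,
`m ⊥ a + b`, and `p ∣ b`, `p ∣ m` give `p ∣ 3a²`); but then `b = 3b₁`, `m = 3·m₁` with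
`m₁ = a² + 3ab₁ + 3b₁² ≡ a² ≢ 0 (mod 3)` and `m₁ ≥ 7`, so `m₁` has a prime factor `q ≠ 3`, which divides
`m`, hence would again be `3` — contradiction. [folklore] -/
theorem exists_prime_dvd_cofactor_not_dvd {a b c : ℕ} (h : IsABCTriple a b c) :
    ∃ p : ℕ, p.Prime ∧ p ∣ 3 * a ^ 2 + 3 * a * b + b ^ 2 ∧ ¬ p ∣ a * b * c := by
  obtain ⟨ha, hb, hsum, hcop⟩ := h
  subst hsum
  -- a prime dividing both `m` and `abc` is `3`, and then `3 ∣ b`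
  have key : ∀ p : ℕ, p.Prime → p ∣ 3 * a ^ 2 + 3 * a * b + b ^ 2 → p ∣ a * b * (a + b) →
      p = 3 ∧ 3 ∣ b := by
    intro p hp hpm hpabc
    rcases (Nat.Prime.dvd_mul hp).mp hpabc with hpab | hpc
    · rcases (Nat.Prime.dvd_mul hp).mp hpab with hpa | hpb
      · exact absurd hpa (not_dvd_of_coprime hp (coprime_left_cofactor hcop) hpm)
      · have e : 3 * a ^ 2 + 3 * a * b + b ^ 2 = 3 * a ^ 2 + b * (3 * a + b) := by ring
        rw [e] at hpm
        have h3a2 : p ∣ 3 * a ^ 2 := (Nat.dvd_add_left (hpb.mul_right _)).mp hpm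
        rcases (Nat.Prime.dvd_mul hp).mp h3a2 with hp3 | hpa2
        · have hp3' : p = 3 := (Nat.prime_dvd_prime_iff_eq hp Nat.prime_three).mp hp3
          exact ⟨hp3', hp3' ▸ hpb⟩
        · exact absurd (hp.dvd_of_dvd_pow hpa2) (not_dvd_of_coprime hp hcop hpb)
    · exact absurd hpc (not_dvd_of_coprime hp (coprime_sum_cofactor hcop) hpm)
  by_contra hne
  push Not at hne
  have ha2 : 1 ≤ a ^ 2 := Nat.one_le_pow _ _ ha
  have hm1 : 3 * a ^ 2 + 3 * a * b + b ^ 2 ≠ 1 := by omega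
  obtain ⟨p, hp, hpm⟩ := Nat.exists_prime_and_dvd hm1
  obtain ⟨-, b₁, rfl⟩ := key p hp hpm (hne p hp hpm)
  -- now `b = 3 * b₁`
  have hb₁ : 0 < b₁ := by omega
  have h3a : ¬ 3 ∣ a := not_dvd_of_coprime Nat.prime_three hcop (dvd_mul_right 3 b₁)
  have em : 3 * a ^ 2 + 3 * a * (3 * b₁) + (3 * b₁) ^ 2 = 3 * (a ^ 2 + 3 * (a * b₁ + b₁ ^ 2)) := by
    ring
  have h3m₁ : ¬ 3 ∣ a ^ 2 + 3 * (a * b₁ + b₁ ^ 2) := fun h3 =>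
    h3a (Nat.prime_three.dvd_of_dvd_pow ((Nat.dvd_add_left (dvd_mul_right 3 _)).mp h3))
  have hm₁1 : a ^ 2 + 3 * (a * b₁ + b₁ ^ 2) ≠ 1 := by
    have : 1 ≤ b₁ ^ 2 := Nat.one_le_pow _ _ hb₁
    omega
  obtain ⟨q, hq, hqm₁⟩ := Nat.exists_prime_and_dvd hm₁1
  have hqm : q ∣ 3 * a ^ 2 + 3 * a * (3 * b₁) + (3 * b₁) ^ 2 := by
    rw [em]
    exact hqm₁.mul_left 3
  obtain ⟨rfl, -⟩ := key q hq hqm (hne q hq hqm)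
  exact h3m₁ hqm₁

/-- The cubic lift strictly increases the number of prime factors:
`ω(abc) + 1 ≤ ω(a³ · b(3a² + 3ab + b²) · c³)`. [folklore] -/
theorem card_primeFactors_lift {a b c : ℕ} (h : IsABCTriple a b c) :
    (a * b * c).primeFactors.card + 1 ≤
      (a ^ 3 * (b * (3 * a ^ 2 + 3 * a * b + b ^ 2)) * c ^ 3).primeFactors.card := by
  obtain ⟨p, hp, hpm, hpabc⟩ := exists_prime_dvd_cofactor_not_dvd h
  obtain ⟨ha, hb, hsum, -⟩ := h
  have hc : 0 < c := by omega
  have hm0 : 0 < 3 * a ^ 2 + 3 * a * b + b ^ 2 := Nat.add_pos_right _ (pow_pos hb 2)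
  have hN0 : a ^ 3 * (b * (3 * a ^ 2 + 3 * a * b + b ^ 2)) * c ^ 3 ≠ 0 := by positivity
  have hsub : (a * b * c).primeFactors ⊆
      (a ^ 3 * (b * (3 * a ^ 2 + 3 * a * b + b ^ 2)) * c ^ 3).primeFactors :=
    Nat.primeFactors_mono (mul_dvd_mul (mul_dvd_mul (dvd_pow_self a (by norm_num))
      (dvd_mul_right b _)) (dvd_pow_self c (by norm_num))) hN0
  have hpN : p ∈ (a ^ 3 * (b * (3 * a ^ 2 + 3 * a * b + b ^ 2)) * c ^ 3).primeFactors :=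
    Nat.mem_primeFactors.mpr ⟨hp, ((hpm.mul_left b).mul_left (a ^ 3)).mul_right (c ^ 3), hN0⟩
  have hpn : p ∉ (a * b * c).primeFactors := fun h' => hpabc (Nat.dvd_of_mem_primeFactors h')
  exact Finset.card_lt_card ((Finset.ssubset_iff_of_subset hsub).mpr ⟨p, hpN, hpn⟩)

/-- The radical of the cubic lift: `rad(a³ · bm · c³) ≤ rad(abc) · m` (`m = 3a² + 3ab + b²`), from
`radical (xy) ∣ radical x · radical y`, `radical (x³) = radical x` and `radical m ∣ m`. [folklore] -/
theorem rad_lift_le {a b c : ℕ} (h : IsABCTriple a b c) :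
    rad (a ^ 3) (b * (3 * a ^ 2 + 3 * a * b + b ^ 2)) (c ^ 3) ≤
      rad a b c * (3 * a ^ 2 + 3 * a * b + b ^ 2) := by
  obtain ⟨ha, hb, hsum, hcop⟩ := h
  set m := 3 * a ^ 2 + 3 * a * b + b ^ 2 with hm
  have hm0 : 0 < m := Nat.add_pos_right _ (pow_pos hb 2)
  have hab : IsRelPrime a b := Nat.coprime_iff_isRelPrime.mp hcop
  have habc : IsRelPrime (a * b) c := by
    rw [← Nat.coprime_iff_isRelPrime, ← hsum]
    exact Nat.Coprime.mul_left (Nat.coprime_self_add_right.mpr hcop)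
      (Nat.coprime_add_self_right.mpr hcop.symm)
  rw [rad_def, rad_def]
  have h1 : radical (a ^ 3 * (b * m) * c ^ 3) ∣ radical (a * b * c) * radical m :=
    calc radical (a ^ 3 * (b * m) * c ^ 3)
        ∣ radical (a ^ 3 * (b * m)) * radical (c ^ 3) := radical_mul_dvd
      _ ∣ radical (a ^ 3) * radical (b * m) * radical (c ^ 3) :=
          mul_dvd_mul_right radical_mul_dvd _
      _ ∣ radical (a ^ 3) * (radical b * radical m) * radical (c ^ 3) :=
          mul_dvd_mul_right (mul_dvd_mul_left _ radical_mul_dvd) _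
      _ = radical (a * b * c) * radical m := by
          rw [radical_pow a (by norm_num : (3 : ℕ) ≠ 0), radical_pow c (by norm_num : (3 : ℕ) ≠ 0),
            radical_mul habc, radical_mul hab]
          ring
  calc radical (a ^ 3 * (b * m) * c ^ 3)
      ≤ radical (a * b * c) * radical m :=
        Nat.le_of_dvd (Nat.mul_pos (Nat.radical_pos _) (Nat.radical_pos _)) h1
    _ ≤ radical (a * b * c) * m := Nat.mul_le_mul_left _ (Nat.le_of_dvd hm0 radical_dvd_self)

/-! ### The real-variable transfer -/

/-- **Exponent bookkeeping of one lift.** If `1 ≤ c`, `1 ≤ R`, `0 < R' ≤ 3c²R` and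
`c³ < C · R'^{1+η}` with `η = ε/(3+2ε)` (so that `(1+η)/(1−2η) = 1+ε`), then
`c < C' · R^{1+ε}` with `C' = exp((log (max C 1) + (1+η) log 3)/(1−2η))` depending on `C, ε` only.
Proof: take logarithms, `(1−2η) log c < log C₊ + (1+η) log 3 + (1+η) log R`, and exponentiate.
[folklore] -/
theorem real_transfer {ε C c R R' : ℝ} (hε : 0 < ε) (hc : 1 ≤ c) (hR : 1 ≤ R) (hR'0 : 0 < R')
    (hR' : R' ≤ 3 * c ^ 2 * R) (hlt : c ^ 3 < C * R' ^ (1 + ε / (3 + 2 * ε))) :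
    c < Real.exp ((Real.log (max C 1) + (1 + ε / (3 + 2 * ε)) * Real.log 3) /
        (1 - 2 * (ε / (3 + 2 * ε)))) * R ^ (1 + ε) := by
  set η : ℝ := ε / (3 + 2 * ε) with hη
  have h32 : (0 : ℝ) < 3 + 2 * ε := by positivity
  have hη0 : 0 < η := by positivity
  have hθ : 1 - 2 * η = 3 / (3 + 2 * ε) := by
    rw [hη]
    field_simp
    ring
  have hθ0 : 0 < 1 - 2 * η := by
    rw [hθ]
    positivity
  have hid : 1 + η = (1 + ε) * (1 - 2 * η) := by
    rw [hθ, hη]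
    field_simp
    ring
  have hc0 : 0 < c := by linarith
  have hR0 : 0 < R := by linarith
  have hC1 : (0 : ℝ) < max C 1 := lt_max_of_lt_right one_pos
  have hpow0 : 0 < R' ^ (1 + η) := Real.rpow_pos_of_pos hR'0 _
  -- replace `C` by `max C 1`
  have hlt' : c ^ 3 < max C 1 * R' ^ (1 + η) :=
    hlt.trans_le (mul_le_mul_of_nonneg_right (le_max_left _ _) hpow0.le)
  -- logarithms
  have hL0 : 0 ≤ Real.log c := Real.log_nonneg hc
  have hρ0 : 0 ≤ Real.log R := Real.log_nonneg hR
  have h1 : 3 * Real.log c < Real.log (max C 1) + (1 + η) * Real.log R' := by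
    have h := Real.log_lt_log (by positivity) hlt'
    rw [Real.log_pow, Real.log_mul hC1.ne' hpow0.ne', Real.log_rpow hR'0] at h
    push_cast at h
    linarith
  have h2 : Real.log R' ≤ Real.log 3 + 2 * Real.log c + Real.log R := by
    have h := Real.log_le_log hR'0 hR'
    rw [Real.log_mul (by positivity) hR0.ne', Real.log_mul (by norm_num) (by positivity),
      Real.log_pow] at h
    push_cast at h
    linarith
  have h2' : (1 + η) * Real.log R' ≤ (1 + η) * (Real.log 3 + 2 * Real.log c + Real.log R) :=
    mul_le_mul_of_nonneg_left h2 (by linarith)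
  have h3 : (1 - 2 * η) * Real.log c <
      Real.log (max C 1) + (1 + η) * Real.log 3 + (1 + η) * Real.log R := by
    nlinarith
  -- divide by `1 - 2η` and use `(1 + η) = (1 + ε)(1 − 2η)`
  have h4 : Real.log c <
      (Real.log (max C 1) + (1 + η) * Real.log 3) / (1 - 2 * η) + (1 + ε) * Real.log R := by
    rw [div_add' _ _ _ hθ0.ne', lt_div_iff₀ hθ0]
    have e : (1 + ε) * Real.log R * (1 - 2 * η) = (1 + η) * Real.log R := by
      rw [hid]
      ring
    linarith
  -- exponentiate
  calc c = Real.exp (Real.log c) := (Real.exp_log hc0).symm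
    _ < Real.exp ((Real.log (max C 1) + (1 + η) * Real.log 3) / (1 - 2 * η) +
          (1 + ε) * Real.log R) := Real.exp_lt_exp.mpr h4
    _ = Real.exp ((Real.log (max C 1) + (1 + η) * Real.log 3) / (1 - 2 * η)) * R ^ (1 + ε) := by
          rw [Real.exp_add, Real.rpow_def_of_pos hR0, mul_comm (Real.log R) (1 + ε)]

/-! ### The ω-lift -/

/-- **One ω-lift.** The abc conjecture for the triples with at least `j + 1` prime factors of `abc`
implies the abc conjecture for the triples with at least `j` prime factors: lift the triple
cubically (one more prime, `rad ↦ ≤ 3c²·rad`, `c ↦ c³`) and transfer the bound with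
`η = ε/(3+2ε)`. [folklore] -/
theorem manyPrimes_step (j : ℕ)
    (h : ∀ ε : ℝ, 0 < ε → ∃ C : ℝ, ∀ a b c : ℕ, IsABCTriple a b c →
      j + 1 ≤ (a * b * c).primeFactors.card → (c : ℝ) < C * ((rad a b c : ℕ) : ℝ) ^ (1 + ε)) :
    ∀ ε : ℝ, 0 < ε → ∃ C : ℝ, ∀ a b c : ℕ, IsABCTriple a b c →
      j ≤ (a * b * c).primeFactors.card → (c : ℝ) < C * ((rad a b c : ℕ) : ℝ) ^ (1 + ε) := by
  intro ε hε
  obtain ⟨C, hC⟩ := h (ε / (3 + 2 * ε)) (by positivity)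
  refine ⟨Real.exp ((Real.log (max C 1) + (1 + ε / (3 + 2 * ε)) * Real.log 3) /
      (1 - 2 * (ε / (3 + 2 * ε)))), ?_⟩
  intro a b c ht hj
  have ht' := isABCTriple_lift ht
  have hcard := card_primeFactors_lift ht
  have hlt := hC _ _ _ ht' (by omega)
  have hrad := rad_lift_le ht
  have hm := cofactor_le ht
  obtain ⟨ha, hb, hsum, -⟩ := ht
  have hc1 : (1 : ℝ) ≤ c := by exact_mod_cast (show 1 ≤ c by omega)
  have hR1 : (1 : ℝ) ≤ ((rad a b c : ℕ) : ℝ) := by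
    exact_mod_cast (show 0 < rad a b c from Nat.radical_pos _)
  have hR'0 : (0 : ℝ) < ((rad (a ^ 3) (b * (3 * a ^ 2 + 3 * a * b + b ^ 2)) (c ^ 3) : ℕ) : ℝ) := by
    exact_mod_cast (show 0 < rad (a ^ 3) (b * (3 * a ^ 2 + 3 * a * b + b ^ 2)) (c ^ 3) from
      Nat.radical_pos _)
  have hR' : ((rad (a ^ 3) (b * (3 * a ^ 2 + 3 * a * b + b ^ 2)) (c ^ 3) : ℕ) : ℝ) ≤
      3 * (c : ℝ) ^ 2 * ((rad a b c : ℕ) : ℝ) := by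
    have h' : rad (a ^ 3) (b * (3 * a ^ 2 + 3 * a * b + b ^ 2)) (c ^ 3) ≤ 3 * c ^ 2 * rad a b c :=
      hrad.trans (by rw [mul_comm]; exact Nat.mul_le_mul_right _ hm)
    exact_mod_cast h'
  have hlt' : (c : ℝ) ^ 3 <
      C * (((rad (a ^ 3) (b * (3 * a ^ 2 + 3 * a * b + b ^ 2)) (c ^ 3) : ℕ) : ℝ)) ^
        (1 + ε / (3 + 2 * ε)) := by
    exact_mod_cast hlt
  exact real_transfer hε hc1 hR1 hR'0 hR' hlt'

/-- **ω-lift (all primes).** For every `k`: the abc conjecture restricted to the abc triples with at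
least `k` distinct prime factors of `abc` implies `ABC`. (Iterate `manyPrimes_step` down to `k = 0`.)
[folklore] -/
theorem abc_of_manyPrimes (k : ℕ)
    (h : ∀ ε : ℝ, 0 < ε → ∃ C : ℝ, ∀ a b c : ℕ, IsABCTriple a b c →
      k ≤ (a * b * c).primeFactors.card → (c : ℝ) < C * ((rad a b c : ℕ) : ℝ) ^ (1 + ε)) :
    _root_.ABC := by
  induction k with
  | zero =>
    unfold ABC Literature.Abc.ABCConjecture
    intro ε hε
    obtain ⟨C, hC⟩ := h ε hε
    refine ⟨max C 1, lt_max_of_lt_right one_pos, fun a b c ht => ?_⟩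
    exact (hC a b c ht (Nat.zero_le _)).trans_le
      (mul_le_mul_of_nonneg_right (le_max_left _ _) (by positivity))
  | succ k ih => exact ih (manyPrimes_step k h)

/-- Every abc triple has `2 ∣ abc` (one of `a`, `b`, `a + b` is even). [folklore] -/
theorem two_dvd_of_isABCTriple {a b c : ℕ} (h : IsABCTriple a b c) : 2 ∣ a * b * c := by
  obtain ⟨-, -, hsum, -⟩ := h
  subst hsum
  rcases Nat.even_or_odd a with ha | ha
  · exact ((ha.mul_right b).mul_right (a + b)).two_dvd
  rcases Nat.even_or_odd b with hb | hb
  · exact ((hb.mul_left a).mul_right (a + b)).two_dvd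
  · exact ((Odd.add_odd ha hb).mul_left (a * b)).two_dvd

/-- For an abc triple, the odd prime factors of `abc` are all prime factors but `2`:
`#{p ∣ abc prime, p ≠ 2} + 1 = ω(abc)`. [folklore] -/
theorem card_filter_ne_two {a b c : ℕ} (h : IsABCTriple a b c) :
    ((a * b * c).primeFactors.filter (fun p => p ≠ 2)).card + 1 = (a * b * c).primeFactors.card := by
  have h2 := two_dvd_of_isABCTriple h
  obtain ⟨ha, hb, hsum, -⟩ := h
  have h0 : a * b * c ≠ 0 := by
    have hc : 0 < c := by omega
    positivity
  rw [Finset.filter_ne', Finset.card_erase_add_one]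
  exact Nat.mem_primeFactors.mpr ⟨Nat.prime_two, h2, h0⟩

/-- **ω-lift (odd primes).** For every `k`: the abc conjecture restricted to the abc triples with at
least `k` distinct ODD prime factors of `abc` implies `ABC` — the form matching the route's
many-prime cruxes (`4 ≤ #{odd multiplicative primes}` of the Frey curve = `4 ≤ #{odd p ∣ abc}`).
[folklore] -/
theorem abc_of_manyOddPrimes (k : ℕ)
    (h : ∀ ε : ℝ, 0 < ε → ∃ C : ℝ, ∀ a b c : ℕ, IsABCTriple a b c →
      k ≤ ((a * b * c).primeFactors.filter (fun p => p ≠ 2)).card →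
        (c : ℝ) < C * ((rad a b c : ℕ) : ℝ) ^ (1 + ε)) :
    _root_.ABC :=
  abc_of_manyPrimes (k + 1) fun ε hε => by
    obtain ⟨C, hC⟩ := h ε hε
    exact ⟨C, fun a b c ht hk => hC a b c ht (by have := card_filter_ne_two ht; omega)⟩

end OmegaLift

end Summit.ABC.ABC.Theorems

end
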